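import Literature.Geometry.Riemannian.RicciFlowMaximal
import Literature.Geometry.Riemannian.PerelmanEntropy
import Literature.Geometry.Riemannian.RiemannianDistance
import Literature.Geometry.Lorentzian.LeviCivita
import Literature.Geometry.Lorentzian.EnergyCurrents
import Literature.Geometry.Lorentzian.Volume
import HarnessLib

/-!
# Bamler's tangent flow at `-∞` of a non-collapsed sequence of compact 4-dimensional Ricci flows
# (named fact, smooth export)

The named fact `bamler_orbifoldTangentFlowAtInfinity_four` (no `_holds`: Bamler's theory of metric flows,
𝔽-convergence, conjugate heat kernels and Nash entropy is not in the tree) packages, clause by clause and in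
the smooth vocabulary of the tree (Ricci flows `IsRicciFlow`, Perelman's `μ` `PseudoRiemannianMetric.muEntropy`,
curvature bounds `CurvatureBoundedBy`, the Riemannian measure `riemannianMeasure`, the Riemannian distance
`PseudoRiemannianMetric.edist`), PRINTED statements of

* R. Bamler, *Entropy and heat kernel bounds on a Ricci flow background*, arXiv:2008.07093 (2020a):
  §5, display after Prop. 5.2 (`𝒩_{x₀,t₀}(τ) ≥ (1/τ)∫₀^τ μ[g_{t₀-τ'}, τ'] dτ' ≥ μ[g_{t₀-τ}, τ]`, "so a lower
  bound on the pointed Nash entropy is common in Ricci flows with non-degenerate initial data"); §10,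
  Thm. 10.1 (ε-regularity: `𝒩_{x,t}(r²) ≥ -ε_n ⇒ r_Rm(x,t) ≥ ε_n r`, i.e. `|Rm| ≤ (ε_n r)⁻²` on `P(x,t;ε_n r)`);
* R. Bamler, *Compactness theory of the space of super Ricci flows*, Invent. Math. 233 (2023) (2020b):
  existence of 𝔽-limits of sequences of pointed Ricci flows, convergence of points within a
  correspondence, tangent flows at infinity as 𝔽-limits of parabolic rescalings;
* R. Bamler, *Structure theory of non-collapsed limits of Ricci flows*, arXiv:2009.03243 (2020c): Thm. 2.4
  [arXiv v2 numbering Thm 4] (the 𝔽-convergence is smooth on the regular part `ℛ`), Thm. 2.9 [Thm 9]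
  (pointed Nash entropies converge to those of the limit), Thm. 2.16 [Thm 15] (constant Nash entropy `W` ⇒
  metric soliton; on `ℛ`: `Ric + ∇²f - g/2τ = 0`, `-τ(R + |∇f|²) + f = W`; model `(X, d, μ)` with
  `μ(𝒮_X) = 0`, `dμ = (4π)^{-n/2} e^{-f} dg` on `ℛ_X` at `τ = 1`, `X` a metric cone or `R > 0` on `ℛ_X`),
  §2.7 with Thm. 2.40 [Thm 29] (setting: pointed flows on COMPACT manifolds, `T_i → ∞`, `𝒩_{x_i,0}(τ₀) ≥ -Y₀`
  — "such a sequence arises, for example, when we take the blow-ups near singularities"; the bound passes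
  to the limit, `𝒩_𝒳(∞)` is independent of the basepoint; every tangent flow at infinity is a metric soliton
  with `𝒩 ≡ 𝒩_𝒳(∞)`, itself an 𝔽-limit of parabolic rescalings of the `(M_i, g_i)`; `𝒩_𝒳(∞) ≥ -ε_n ⇒ 𝒳`
  is the constant flow on Euclidean space), §2.10 Thm. 2.46 [Thm 35] (n = 4: `X` is the length space of a
  complete smooth Riemannian ORBIFOLD with isolated singularities; a metric cone is `ℝ⁴/Γ`, `Γ ⊂ O(4)` finite).

specialised to: a FIXED closed connected 4-manifold `M`, flows on `[-A_k, 0]` with `A_k ≥ k`, `|Rm| ≤ 1`,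
an anchor `|Rm|(x_k, 0) ≥ c > 0`, and the Nash-entropy bound in the stronger form of a uniform floor
`F ≤ μ(g_k(t), τ)` for all `t, τ`.

Users take `(h : bamler_orbifoldTangentFlowAtInfinity_four)`; first user: line `ancient-sphere-rigidity` of
the crux `EntropyRung.SubcylindricalRecognition` (Summits/SmoothPoincare4), whose registered stub
`stub_orbifoldTangentFlow` is this proposition verbatim.

## What is NOT here

Metric flows, 𝔽-distance/𝔽-convergence, `H_n`-concentration, the pointed Nash entropy of a flow, metric
solitons, the regular/singular decomposition — i.e. everything needed to PROVE the fact from Bamler's three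
papers; and the general (all `n`, varying `M_i`) statements.

## References

* R. H. Bamler, *Entropy and heat kernel bounds on a Ricci flow background*, arXiv:2008.07093 (2020),
  §5 Prop. 5.2 and the display following it; §10 Thm. 10.1. [Bamler2020Entropy]
* R. H. Bamler, *Compactness theory of the space of super Ricci flows*, Invent. Math. 233 (2023),
  1121–1277, Thm. 1.2 (existence of 𝔽-limits), §6 (convergence within a correspondence), §9
  (smooth convergence on the regular part). [Bamler2023]
* R. H. Bamler, *Structure theory of non-collapsed limits of Ricci flows*, arXiv:2009.03243 (2020),
  Thms. 2.4, 2.9, 2.16, 2.40, 2.46 (arXiv v2 theorem numbers 4, 9, 15, 29, 35). [Bamler2020Structure]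
-/

noncomputable section

open scoped Manifold ContDiff Topology ENNReal NNReal
open Set MeasureTheory

namespace Literature.Geometry.Riemannian

open Lorentzian

/-- **Bamler's tangent flow at `-∞` of a non-collapsed sequence of compact 4-dimensional Ricci flows,
exported in smooth vocabulary.** Let `M` be a closed connected smooth 4-manifold and
`(g_k(t))_{t ∈ [-A_k, 0]}`, `A_k ≥ k`, Ricci flows of Riemannian metrics on `M` (with Levi-Civita witnesses
`cov_k`), `|Rm| ≤ 1`, with an anchor `|Rm_{g_k(0)}|(x_k) ≥ c > 0` on a `g_k(0)`-sub-unit quadruple, and a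
uniform entropy floor `F ≤ μ(g_k(t), τ)` for all `t ∈ [-A_k, 0]`, `τ > 0` (Perelman's `μ`,
`PerelmanEntropy.lean`). By the display after [Bamler 2020a, Prop. 5.2] the pointed Nash entropies satisfy
`𝒩_{x_k,0}(τ) ≥ μ[g_k(-τ), τ] ≥ F` for `τ ≤ A_k → ∞`, which is the setting of [Bamler 2020c, §2.7]. Pass to an
𝔽-convergent subsequence (2020b) with limit `𝒳` over `(-∞, 0]`; `𝒩_x(τ) ≥ F` on `𝒳` and
`W := 𝒩_𝒳(∞) ≥ F` (§2.7 with Thm. 2.9). Let `𝒳'` be a tangent flow at infinity: a metric soliton with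
`𝒩 ≡ W` (Thm. 2.40), itself an 𝔽-limit of parabolic rescalings `λ_j g_{k_j}(λ_j⁻¹ ·)` of the given compact
flows, to which Thm. 2.16 and Thm. 2.46 apply. CONCLUSION, read off the printed statements: the regular
part `S := ℛ_X` of the time `-1` slice (a smooth 4-manifold, Hausdorff, second countable) with its metric
`g` and the potential `f` satisfies `Ric + ∇²f = g/2`, `R + |∇f|² = f - W` (Thm. 2.16 at `τ = 1`),
`∫_S e^{-f} dg = 16π²` (`dμ = (4π)⁻² e^{-f} dg` is a probability measure and `μ(𝒮_X) = 0`, Thm. 2.16);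
`F ≤ W`; `W < 0` (if `W ≥ -ε₄` then `𝒳` is the constant Euclidean flow by Thm. 2.40, so
`𝒩_{x_k,0}(r²) → 0` by Thm. 2.9 and the ε-regularity Thm. 10.1 of 2020a forces `|Rm|(x_k,0) ≤ (ε₄ r)⁻² < c`
for large `r ≤ √A_k` — contradicting the anchor); either `R > 0` on `S` or there is a cone point (Thm. 2.16:
`X` is a metric cone or `R > 0`; by Thm. 2.46 a metric cone is `ℝ⁴/Γ`, whose vertex is a singular point
unless `Γ = 1`, and `X = ℝ⁴` has `f = |y - y₀|²/4 + W` with `∫(4π)⁻² e^{-f} = 1`, i.e. `W = 0`, excluded);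
the singular points of `X` are isolated orbifold points (Thm. 2.46): each has a punctured orbifold chart
`(B_r ∖ 0)/Γ → S`, `Γ ⊂ O(4)` finite of order `k ≥ 2` acting freely on `S³`, in which the metric extends
smoothly over `0` (linearly normalised to be Euclidean at `0`; exported as the chart metric `gc` on `B_r`),
so that `|y|²` descends to a smooth function `ρ` and the fibres of the chart are the `Γ`-orbits, of
cardinality `k`; by Thm. 2.4 applied to `𝒳'`, every compact sub-annulus `{ε ≤ |y| ≤ r}/Γ` of such a chart is
transplanted, for every `η > 0`, into some rescaled slice `(M, λ g_k(t))`, `t ∈ [-A_k, 0]`, `λ > 0`, of the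
given flows by a `k`-to-`1` local diffeomorphism `Φ` (chart followed by the convergence diffeomorphism)
with `(1-η) gc ≤ λ Φ^* g_k(t) ≤ (1+η) gc`, open image, the descent `ρ` of `|y|²`, and
`|R_{g_k(t)}| ≤ λ Λ` on the image for a constant `Λ` of the chart (smooth convergence of curvatures); and if
there is no singular point, then `S = X` is complete (Def. 2.12/Thm. 2.46: `X` is the completion of `ℛ_X`)
and connected, and if moreover `S` is compact then (Thm. 2.4 again, on `S × {-1} ⊆ ℛ'`) `S` immerses
injectively and smoothly into `M`. Special case `n = 4`, fixed compact `M`, of the cited theorems; the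
general statements (metric flows, 𝔽-convergence, all dimensions) are not in the tree.
-- TODO(general form): Bamler 2020c Thms 2.4, 2.9, 2.16, 2.40, 2.46 for 𝔽-limits of arbitrary
-- non-collapsed sequences of compact n-dimensional Ricci flows (needs metric flows and 𝔽-distance).
[cite: Bamler2020Structure, §2.1 Thm 2.4; §2.2 Thm 2.9; §2.4 Thm 2.16; §2.7 Thm 2.40; §2.10 Thm 2.46]
[cite: Bamler2020Entropy, §5 Prop 5.2; §10 Thm 10.1] [cite: Bamler2023, Thm 1.2]
-/
def bamler_orbifoldTangentFlowAtInfinity_four : Prop :=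
    ∀ (M : Type) [TopologicalSpace M] [T2Space M] [SecondCountableTopology M]
      [ChartedSpace (EuclideanSpace ℝ (Fin 4)) M] [IsManifold (𝓡 4) ∞ M] [CompactSpace M]
      [ConnectedSpace M] [T3Space M] [MeasurableSpace M] [BorelSpace M]
      (A : ℕ → ℝ)
      (gk : ℕ → ℝ → PseudoRiemannianMetric (𝓡 4) ∞ (EuclideanSpace ℝ (Fin 4)) (TangentSpace (𝓡 4) : M → Type _))
      (covk : ℕ → ℝ → CovariantDerivative (𝓡 4) (EuclideanSpace ℝ (Fin 4)) (TangentSpace (𝓡 4) : M → Type _))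
      (xk : ℕ → M) (F c : ℝ), 0 < c →
      (∀ k : ℕ, (k : ℝ) ≤ A k) →
      (∀ k, IsRicciFlow (gk k) (covk k) (Set.Icc (-(A k)) 0)) →
      (∀ k, ∀ t ∈ Set.Icc (-(A k)) 0, (gk k t).IsRiemannian) →
      (∀ k, ∀ t ∈ Set.Icc (-(A k)) 0, CurvatureBoundedBy (gk k t) (covk k t) 1) →
      (∀ k, ∃ X Y Z W : TangentSpace (𝓡 4) (xk k),
        (gk k 0).val (xk k) X X ≤ 1 ∧ (gk k 0).val (xk k) Y Y ≤ 1 ∧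
        (gk k 0).val (xk k) Z Z ≤ 1 ∧ (gk k 0).val (xk k) W W ≤ 1 ∧
        c ≤ |(gk k 0).curvatureForm (covk k 0) (xk k) X Y Z W|) →
      (∀ k, ∀ t ∈ Set.Icc (-(A k)) 0, ∀ τ : ℝ, 0 < τ → ((F : ℝ) : EReal) ≤ (gk k t).muEntropy (covk k t) τ) →
      ∃ (S : Type) (_ : TopologicalSpace S) (_ : T2Space S) (_ : SecondCountableTopology S)
        (_ : ChartedSpace (EuclideanSpace ℝ (Fin 4)) S) (_ : IsManifold (𝓡 4) ∞ S)
        (_ : T3Space S) (_ : MeasurableSpace S) (_ : BorelSpace S)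
        (gS : PseudoRiemannianMetric (𝓡 4) ∞ (EuclideanSpace ℝ (Fin 4)) (TangentSpace (𝓡 4) : S → Type _))
        (_ : gS.HasLeviCivita) (f : S → ℝ) (hS : gS.IsRiemannian) (W : ℝ)
        -- cone data: index type, sheet numbers, chart radii, scalar-curvature bounds, orbifold chart metrics
        (ι : Type) (kc : ι → ℕ) (rc Λc : ι → ℝ)
        (gc : ι → EuclideanSpace ℝ (Fin 4) →
          (EuclideanSpace ℝ (Fin 4) →L[ℝ] EuclideanSpace ℝ (Fin 4) →L[ℝ] ℝ)),
        -- (E1) soliton identities in Bamler's normalisation (2020c Thm 15 at τ = 1)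
        ContMDiff (𝓡 4) 𝓘(ℝ, ℝ) ∞ f ∧
        (∀ (x : S) (X Y : TangentSpace (𝓡 4) x),
          gS.ricci x X Y + gS.hessian f x X Y = (1 / 2 : ℝ) * gS.val x X Y) ∧
        (∀ x : S, gS.scalarCurvature x + gS.gradSq f x = f x - W) ∧
        -- (E2) `(4π)⁻² e^{-f} dg` is a probability measure on the regular part (μ(𝒮_X) = 0)
        ∫⁻ x, ENNReal.ofReal (Real.exp (-f x))
            ∂(riemannianMeasure (gS.toContMDiffRiemannianMetric hS)) =
          ENNReal.ofReal (16 * Real.pi ^ 2) ∧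
        -- (E3) entropy: the floor passes to `W = 𝒩_𝒳(∞)`; the anchor makes the limit non-flat
        F ≤ W ∧ W < 0 ∧
        -- (E4) Thm 15/35 dichotomy: positive scalar curvature, or a cone point
        ((∀ x : S, 0 < gS.scalarCurvature x) ∨ Nonempty ι) ∧
        -- (E5) orbifold chart metrics at the cone points, Euclidean at the vertex
        (∀ i, 2 ≤ kc i ∧ 0 < rc i ∧ 0 ≤ Λc i ∧
          ContDiffOn ℝ ∞ (gc i) (Metric.ball 0 (rc i)) ∧
          (∀ v w : EuclideanSpace ℝ (Fin 4), gc i 0 v w = inner ℝ v w) ∧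
          (∀ y ∈ Metric.ball (0 : EuclideanSpace ℝ (Fin 4)) (rc i), ∀ v w, gc i y v w = gc i y w v) ∧
          (∀ y ∈ Metric.ball (0 : EuclideanSpace ℝ (Fin 4)) (rc i), ∀ v, v ≠ 0 → 0 < gc i y v v)) ∧
        -- (E6a) transplants of compact sub-annuli of the punctured cone charts into rescaled slices of the
        -- given compact flows (smooth convergence on the regular part, 2020c Thm 4), `k`-sheeted with the
        -- descent `ρ` of `|y|²`, (1±η)-isometric, with scalar curvature control
        (∀ i, ∀ ε η : ℝ, 0 < ε → ε < rc i → 0 < η →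
          ∃ (k : ℕ) (t : ℝ) (_ : t ∈ Set.Icc (-(A k)) 0) (Q : ℝ) (_ : 0 < Q)
            (Φ : EuclideanSpace ℝ (Fin 4) → M) (ρ : M → ℝ),
            ContMDiffOn (𝓡 4) (𝓡 4) ∞ Φ (Metric.ball 0 (rc i) \ Metric.closedBall 0 ε) ∧
            IsOpen (Φ '' (Metric.ball 0 (rc i) \ Metric.closedBall 0 ε)) ∧
            (∀ y ∈ Metric.ball (0 : EuclideanSpace ℝ (Fin 4)) (rc i) \ Metric.closedBall 0 ε,
              Function.Injective (mfderiv (𝓡 4) (𝓡 4) Φ y)) ∧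
            (∀ y ∈ Metric.ball (0 : EuclideanSpace ℝ (Fin 4)) (rc i) \ Metric.closedBall 0 ε,
              (Φ ⁻¹' {Φ y} ∩ (Metric.ball 0 (rc i) \ Metric.closedBall 0 ε)).ncard = kc i) ∧
            ContMDiffOn (𝓡 4) 𝓘(ℝ, ℝ) ∞ ρ (Φ '' (Metric.ball 0 (rc i) \ Metric.closedBall 0 ε)) ∧
            (∀ y ∈ Metric.ball (0 : EuclideanSpace ℝ (Fin 4)) (rc i) \ Metric.closedBall 0 ε,
              ρ (Φ y) = ‖y‖ ^ 2) ∧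
            (∀ y ∈ Metric.ball (0 : EuclideanSpace ℝ (Fin 4)) (rc i) \ Metric.closedBall 0 ε,
              ∀ v : EuclideanSpace ℝ (Fin 4),
                (1 - η) * gc i y v v ≤
                  Q * (gk k t).val (Φ y) (mfderiv (𝓡 4) (𝓡 4) Φ y v) (mfderiv (𝓡 4) (𝓡 4) Φ y v) ∧
                Q * (gk k t).val (Φ y) (mfderiv (𝓡 4) (𝓡 4) Φ y v) (mfderiv (𝓡 4) (𝓡 4) Φ y v) ≤
                  (1 + η) * gc i y v v) ∧
            (∀ y ∈ Metric.ball (0 : EuclideanSpace ℝ (Fin 4)) (rc i) \ Metric.closedBall 0 ε,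
              |(gk k t).scalarCurvatureWith (covk k t) (Φ y)| ≤ Q * Λc i)) ∧
        -- (E6b, E7) no cone point: connected, complete, and compact ⇒ injective immersion into `M` (Thm 4)
        (IsEmpty ι → ConnectedSpace S) ∧
        (IsEmpty ι → ∀ (x : S) (r : NNReal), IsCompact {y : S | gS.edist hS x y ≤ r}) ∧
        (IsEmpty ι → CompactSpace S → ∃ φ : S → M, ContMDiff (𝓡 4) (𝓡 4) ∞ φ ∧ Function.Injective φ ∧
          ∀ x : S, Function.Injective (mfderiv (𝓡 4) (𝓡 4) φ x))

end Literature.Geometry.Riemannian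

end
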